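import Summits.Ventures.Crystal3D.Theorems.StickyWulffConstantGenericWallFloorLineTops
import Summits.Ventures.Crystal3D.Theorems.StickyWulffConstantGenericWallFloorCredits
import Summits.Ventures.Crystal3D.Theorems.StickyWulffConstantGenericWallFloorSlabSealing
import Summits.Ventures.Crystal3D.Theorems.StickyWulffConstantGenericWallFloorMixedDozenRules
import Summits.Ventures.Crystal3D.Theorems.StickyWulffConstantCoaxialWallLawBlockedWindow
import HarnessLib

/-!
# The slot ledger of one clamped grain: where the credits sit, and how many there are

HONEST FRAMING. Part of the venture `Summits/Ventures/Crystal3D` (cell `crystal3d-full`), helper for the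
crux `GenericWallFloor` (stmt-Ventures-19480) of `route-Ventures-StickyWulffConstant`, line `WallLedgerG`:
the rigid-bicrystal rung of `stub_twoSlabAdhesion` by the slot ledger.  Rung credit only.

SETTING (= the bottom half of the cell of `TwoSlabAdhesion`): a `1`-separated configuration `X` in the
cylinder `{−2R₀ ≤ x₂ ≤ h + 2R₀, x₀² + x₁² ≤ ρ²}`, a grain `Λ = A·Λ₀ + t` whose clamped slab sample
`P = Λ ∩ {−2R₀ ≤ x₂ ≤ −R₀, x₀² + x₁² ≤ ρ²}` lies in `X`, `R₀ ≥ 3`.  A ball is a RIM ball when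
`x₀² + x₁² > (ρ − 2)²`; a ball of `X` off `Λ` is FOREIGN.  CLEAN OUTER SLIVER: every ball of `X` with
`x₂ < −2R₀ + 1` is a grain ball (the cell's hypotheses do not exclude foreign balls hiding below the
lowest grain layer; this rung assumes them away, see the census note on the item).

* `outerSlot_not_mem` — for a slot `w` pointing down or sideways (`⟪A w, e₃⟫ ≤ 0`), a sample ball `p` with
  `p + A w ∉ P` has `p + A w ∉ X` (the position is outside the cell): the OUTER CREDITS are genuine.
* `foreign_high_or_rim` — a foreign ball is either above height `−R₀ − 1` or in the rim zone
  (slab sealing `mem_sample_of_mem_core` + clean sliver).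
* `not_outerCredit_of_foreign` — a non-rim sample ball touching a foreign ball carries no outer credit.
* `sub_mem_of_foreign_of_mem_sample` — a non-rim sample ball touching a foreign ball has its `−u` slot
  occupied for every steep up-slot `u` (`⟪A u, e₃⟫ ≥ √2/2`): inner credits are TOP-STRUCTURED.
* `sum_abs_inner_eq_two_mul_sum_down` — `Σ_{12 slots} |⟪A w, e₃⟫| = 2 Σ_{⟪A w,e₃⟫<0} |⟪A w, e₃⟫|`.
* `outerCredits_ge`, `innerCredits_ge` — the credit counts: `Σ_{down w} #{p ∈ P : p + A w ∉ P} ≥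
  2 φ π ρ² − 120√2 π ρ` and `#{structured u-tops} ≥ √2 ⟪A u, e₃⟫ π ρ² − 10√2 π ρ`.

WHAT THIS IS NOT: the per-ball inequality and the grain lemma are the next file; rung F-C1 not moved.
-/

noncomputable section

namespace Summit.Ventures.Crystal3D.Theorems

open Summit.Ventures.Crystal3D Finset
open Literature.MathematicalPhysics.StatisticalMechanics (fccStacking barlowStacking constHagg)
open scoped InnerProductSpace

/-- Coordinate `2` of `A w` is `⟪A w, e₃⟫` and is at most `1` in absolute value for a slot `w`. -/
theorem apply_two_eq_inner_e₃ (v : EuclideanSpace ℝ (Fin 3)) :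
    v 2 = ⟪v, EuclideanSpace.single (2 : Fin 3) (1 : ℝ)⟫_ℝ := by
  rw [EuclideanSpace.inner_single_right]; simp

/-- `|⟪A w, e₃⟫| ≤ 1` for a slot `w`. -/
theorem abs_inner_slot_le_one (A : EuclideanSpace ℝ (Fin 3) ≃ₗᵢ[ℝ] EuclideanSpace ℝ (Fin 3))
    {w : EuclideanSpace ℝ (Fin 3)} (hw : w ∈ fccSlots) :
    |⟪A w, EuclideanSpace.single (2 : Fin 3) (1 : ℝ)⟫_ℝ| ≤ 1 := by
  have h := abs_real_inner_le_norm (A w) (EuclideanSpace.single (2 : Fin 3) (1 : ℝ))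
  rw [LinearIsometryEquiv.norm_map, norm_eq_one_of_mem_fccSlots hw, PiLp.norm_single, norm_one,
    one_mul] at h
  exact h

/-- Lateral radius of `x + v` is at most that of `x` plus `‖v‖`. -/
theorem sqrt_lateral_add_le (x v : EuclideanSpace ℝ (Fin 3)) :
    Real.sqrt ((x + v) 0 ^ 2 + (x + v) 1 ^ 2) ≤ Real.sqrt (x 0 ^ 2 + x 1 ^ 2) + ‖v‖ := by
  have h := lateral_radius_le_add_dist (x + v) x
  rwa [dist_eq_norm, add_sub_cancel_left] at h

/-- **Outer credits are genuine.**  If all of `X` lies in the cell, `p ∈ P` (the clamped sample in the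
bottom window) and `w ∈ Λ₀` is a slot with `⟪A w, e₃⟫ ≤ 0`, then `p + A w ∉ P` forces `p + A w ∉ X`
(the position `p + A w` is a point of `Λ` below or beside the cell). -/
theorem outerSlot_not_mem
    (A : EuclideanSpace ℝ (Fin 3) ≃ₗᵢ[ℝ] EuclideanSpace ℝ (Fin 3)) (t : EuclideanSpace ℝ (Fin 3))
    (X P : Finset (EuclideanSpace ℝ (Fin 3))) (R₀ h ρ : ℝ)
    (hcell : ∀ p ∈ X, -(2 * R₀) ≤ p 2 ∧ p 2 ≤ h + 2 * R₀ ∧ p 0 ^ 2 + p 1 ^ 2 ≤ ρ ^ 2)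
    (hP : ∀ p, p ∈ P ↔ (p ∈ (fun q => A q + t) '' fccStacking 1 (Real.sqrt (2 / 3)) ∧
      -(2 * R₀) ≤ p 2 ∧ p 2 ≤ -R₀ ∧ p 0 ^ 2 + p 1 ^ 2 ≤ ρ ^ 2))
    {w : EuclideanSpace ℝ (Fin 3)} (hwΛ : w ∈ fccStacking 1 (Real.sqrt (2 / 3)))
    (hα : ⟪A w, EuclideanSpace.single (2 : Fin 3) (1 : ℝ)⟫_ℝ ≤ 0)
    {p : EuclideanSpace ℝ (Fin 3)} (hp : p ∈ P) (hnot : p + A w ∉ P) : p + A w ∉ X := by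
  intro hX
  apply hnot
  rw [hP]
  obtain ⟨hpΛ, hp1, hp2, hp3⟩ := (hP p).1 hp
  obtain ⟨hX1, -, hX3⟩ := hcell _ hX
  refine ⟨movedFcc_add_site_mem A t hpΛ hwΛ, hX1, ?_, hX3⟩
  have : (p + A w) 2 = p 2 + ⟪A w, EuclideanSpace.single (2 : Fin 3) (1 : ℝ)⟫_ℝ := by
    rw [PiLp.add_apply, apply_two_eq_inner_e₃ (A w)]
  rw [this]; linarith

/-- **A foreign ball is high or in the rim zone.**  With the slab sample complete in
`[−2R₀, −R₀] × disc ρ` (`ρ ≥ 1`), `X ⊇ P` `1`-separated and the clean outer sliver, a ball `q ∈ X` off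
the grain has `q₂ > −R₀ − 1` or `(ρ − 1)² < q₀² + q₁²`. -/
theorem foreign_high_or_rim
    (A : EuclideanSpace ℝ (Fin 3) ≃ₗᵢ[ℝ] EuclideanSpace ℝ (Fin 3)) (t : EuclideanSpace ℝ (Fin 3))
    (X P : Finset (EuclideanSpace ℝ (Fin 3))) (R₀ ρ : ℝ) (hρ : 1 ≤ ρ)
    (hX : ∀ p ∈ X, ∀ q ∈ X, p ≠ q → 1 ≤ dist p q) (hPX : P ⊆ X)
    (hP : ∀ p, p ∈ P ↔ (p ∈ (fun q => A q + t) '' fccStacking 1 (Real.sqrt (2 / 3)) ∧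
      -(2 * R₀) ≤ p 2 ∧ p 2 ≤ -R₀ ∧ p 0 ^ 2 + p 1 ^ 2 ≤ ρ ^ 2))
    (hclean : ∀ p ∈ X, p 2 < -(2 * R₀) + 1 → p ∈ (fun q => A q + t) '' fccStacking 1 (Real.sqrt (2 / 3)))
    {q : EuclideanSpace ℝ (Fin 3)} (hqX : q ∈ X)
    (hqΛ : q ∉ (fun q => A q + t) '' fccStacking 1 (Real.sqrt (2 / 3))) :
    -R₀ - 1 < q 2 ∨ (ρ - 1) ^ 2 < q 0 ^ 2 + q 1 ^ 2 := by
  by_contra hcon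
  push Not at hcon
  obtain ⟨hq2, hqr⟩ := hcon
  have hlow : -(2 * R₀) + 1 ≤ q 2 := by
    by_contra hlt
    push Not at hlt
    exact hqΛ (hclean q hqX hlt)
  have hPimp : ∀ p : EuclideanSpace ℝ (Fin 3),
      p ∈ (fun y => A y + t) '' barlowStacking 1 (Real.sqrt (2 / 3)) constHagg →
      -(2 * R₀) ≤ p 2 → p 2 ≤ -R₀ → p 0 ^ 2 + p 1 ^ 2 ≤ ρ ^ 2 → p ∈ P :=
    fun p hp h1 h2 h3 => (hP p).2 ⟨hp, h1, h2, h3⟩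
  have hmem := mem_sample_of_mem_core constHagg A t X P (-(2 * R₀)) (-R₀) ρ hρ hPX hX hPimp q hqX
    hlow (by linarith) hqr
  exact hqΛ ((hP q).1 hmem).1

/-- **A non-rim sample ball touching a foreign ball carries no outer credit** (`R₀ ≥ 3`): for every
slot `w` with `⟪A w, e₃⟫ ≤ 0`, `p + A w ∈ P`. -/
theorem not_outerCredit_of_foreign
    (A : EuclideanSpace ℝ (Fin 3) ≃ₗᵢ[ℝ] EuclideanSpace ℝ (Fin 3)) (t : EuclideanSpace ℝ (Fin 3))
    (X P : Finset (EuclideanSpace ℝ (Fin 3))) (R₀ ρ : ℝ) (hR₀ : 3 ≤ R₀) (hρ : R₀ ≤ ρ)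
    (hX : ∀ p ∈ X, ∀ q ∈ X, p ≠ q → 1 ≤ dist p q) (hPX : P ⊆ X)
    (hP : ∀ p, p ∈ P ↔ (p ∈ (fun q => A q + t) '' fccStacking 1 (Real.sqrt (2 / 3)) ∧
      -(2 * R₀) ≤ p 2 ∧ p 2 ≤ -R₀ ∧ p 0 ^ 2 + p 1 ^ 2 ≤ ρ ^ 2))
    (hclean : ∀ p ∈ X, p 2 < -(2 * R₀) + 1 → p ∈ (fun q => A q + t) '' fccStacking 1 (Real.sqrt (2 / 3)))
    {p q : EuclideanSpace ℝ (Fin 3)} (hp : p ∈ P) (hprim : p 0 ^ 2 + p 1 ^ 2 ≤ (ρ - 2) ^ 2)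
    (hqX : q ∈ X) (hqΛ : q ∉ (fun q => A q + t) '' fccStacking 1 (Real.sqrt (2 / 3)))
    (hpq : dist p q = 1)
    {w : EuclideanSpace ℝ (Fin 3)} (hw : w ∈ fccSlots)
    (hα : ⟪A w, EuclideanSpace.single (2 : Fin 3) (1 : ℝ)⟫_ℝ ≤ 0) : p + A w ∈ P := by
  have hρ1 : (1 : ℝ) ≤ ρ := by linarith
  have hρ2 : (0 : ℝ) ≤ ρ - 2 := by linarith
  obtain ⟨hpΛ, hp1, hp2, hp3⟩ := (hP p).1 hp
  -- lateral radius of `p` and of `p + A w`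
  have hsp : Real.sqrt (p 0 ^ 2 + p 1 ^ 2) ≤ ρ - 2 := by
    rw [← Real.sqrt_sq hρ2]; exact Real.sqrt_le_sqrt hprim
  have hlatw : (p + A w) 0 ^ 2 + (p + A w) 1 ^ 2 ≤ ρ ^ 2 := by
    have h1 := sqrt_lateral_add_le p (A w)
    rw [LinearIsometryEquiv.norm_map, norm_eq_one_of_mem_fccSlots hw] at h1
    have h2 : Real.sqrt ((p + A w) 0 ^ 2 + (p + A w) 1 ^ 2) ≤ ρ := by linarith
    have h3 := Real.sq_sqrt (by positivity : (0 : ℝ) ≤ (p + A w) 0 ^ 2 + (p + A w) 1 ^ 2)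
    nlinarith [Real.sqrt_nonneg ((p + A w) 0 ^ 2 + (p + A w) 1 ^ 2)]
  -- where is `q`?  high (then `p` is high) or in the rim (then `p` is a rim ball)
  rcases foreign_high_or_rim A t X P R₀ ρ hρ1 hX hPX hP hclean hqX hqΛ with hq2 | hqr
  · -- `p₂ > −R₀ − 2`, so `p + A w` is still inside the window
    have hpz : -R₀ - 2 < p 2 := by
      have := abs_apply_sub_le_dist p q 2
      rw [hpq] at this
      have := (abs_le.1 this).1
      linarith
    have hα1 : -1 ≤ ⟪A w, EuclideanSpace.single (2 : Fin 3) (1 : ℝ)⟫_ℝ :=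
      (abs_le.1 (abs_inner_slot_le_one A hw)).1
    have e2 : (p + A w) 2 = p 2 + ⟪A w, EuclideanSpace.single (2 : Fin 3) (1 : ℝ)⟫_ℝ := by
      rw [PiLp.add_apply, apply_two_eq_inner_e₃ (A w)]
    rw [hP]
    refine ⟨movedFcc_add_site_mem A t hpΛ (mem_fcc_of_mem_fccSlots hw), ?_, ?_, hlatw⟩
    · rw [e2]; linarith
    · rw [e2]; linarith
  · -- `q` in the rim zone forces `p` to be a rim ball: contradiction
    exfalso
    have h1 := lateral_radius_le_add_dist q p
    rw [dist_comm, hpq] at h1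
    have hq : ρ - 1 < Real.sqrt (q 0 ^ 2 + q 1 ^ 2) := by
      rw [← Real.sqrt_sq (by linarith : (0 : ℝ) ≤ ρ - 1)]
      exact Real.sqrt_lt_sqrt (sq_nonneg _) hqr
    linarith

/-- **Inner credits are top-structured.**  A non-rim sample ball `p` touching a foreign ball has
`p − A u ∈ P` (hence `∈ X`) for every steep up-slot `u` (`⟪A u, e₃⟫ ≥ √2/2`; `R₀ ≥ 3`). -/
theorem sub_mem_sample_of_foreign
    (A : EuclideanSpace ℝ (Fin 3) ≃ₗᵢ[ℝ] EuclideanSpace ℝ (Fin 3)) (t : EuclideanSpace ℝ (Fin 3))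
    (X P : Finset (EuclideanSpace ℝ (Fin 3))) (R₀ ρ : ℝ) (hR₀ : 3 ≤ R₀) (hρ : R₀ ≤ ρ)
    (hX : ∀ p ∈ X, ∀ q ∈ X, p ≠ q → 1 ≤ dist p q) (hPX : P ⊆ X)
    (hP : ∀ p, p ∈ P ↔ (p ∈ (fun q => A q + t) '' fccStacking 1 (Real.sqrt (2 / 3)) ∧
      -(2 * R₀) ≤ p 2 ∧ p 2 ≤ -R₀ ∧ p 0 ^ 2 + p 1 ^ 2 ≤ ρ ^ 2))
    (hclean : ∀ p ∈ X, p 2 < -(2 * R₀) + 1 → p ∈ (fun q => A q + t) '' fccStacking 1 (Real.sqrt (2 / 3)))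
    {p q : EuclideanSpace ℝ (Fin 3)} (hp : p ∈ P) (hprim : p 0 ^ 2 + p 1 ^ 2 ≤ (ρ - 2) ^ 2)
    (hqX : q ∈ X) (hqΛ : q ∉ (fun q => A q + t) '' fccStacking 1 (Real.sqrt (2 / 3)))
    (hpq : dist p q = 1)
    {u : EuclideanSpace ℝ (Fin 3)} (hu : u ∈ fccSlots)
    (hsteep : Real.sqrt 2 / 2 ≤ ⟪A u, EuclideanSpace.single (2 : Fin 3) (1 : ℝ)⟫_ℝ) : p - A u ∈ P := by
  have hρ1 : (1 : ℝ) ≤ ρ := by linarith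
  have hρ2 : (0 : ℝ) ≤ ρ - 2 := by linarith
  obtain ⟨hpΛ, hp1, hp2, hp3⟩ := (hP p).1 hp
  have hsp : Real.sqrt (p 0 ^ 2 + p 1 ^ 2) ≤ ρ - 2 := by
    rw [← Real.sqrt_sq hρ2]; exact Real.sqrt_le_sqrt hprim
  have hneg : p - A u = p + A (-u) := by rw [map_neg]; abel
  have hlatu : (p - A u) 0 ^ 2 + (p - A u) 1 ^ 2 ≤ ρ ^ 2 := by
    rw [hneg]
    have h1 := sqrt_lateral_add_le p (A (-u))
    rw [LinearIsometryEquiv.norm_map, norm_neg, norm_eq_one_of_mem_fccSlots hu] at h1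
    have h2 : Real.sqrt ((p + A (-u)) 0 ^ 2 + (p + A (-u)) 1 ^ 2) ≤ ρ := by linarith
    have h3 := Real.sq_sqrt (by positivity : (0 : ℝ) ≤ (p + A (-u)) 0 ^ 2 + (p + A (-u)) 1 ^ 2)
    nlinarith [Real.sqrt_nonneg ((p + A (-u)) 0 ^ 2 + (p + A (-u)) 1 ^ 2)]
  have hsqrt2 : (1.4 : ℝ) < Real.sqrt 2 := by
    rw [show (1.4 : ℝ) = Real.sqrt (1.4 ^ 2) by rw [Real.sqrt_sq (by norm_num)]]
    exact Real.sqrt_lt_sqrt (by norm_num) (by norm_num)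
  rcases foreign_high_or_rim A t X P R₀ ρ hρ1 hX hPX hP hclean hqX hqΛ with hq2 | hqr
  · have hpz : -R₀ - 2 < p 2 := by
      have := abs_apply_sub_le_dist p q 2
      rw [hpq] at this
      have := (abs_le.1 this).1
      linarith
    have hα1 : ⟪A u, EuclideanSpace.single (2 : Fin 3) (1 : ℝ)⟫_ℝ ≤ 1 :=
      (abs_le.1 (abs_inner_slot_le_one A hu)).2
    have e2 : (p - A u) 2 = p 2 - ⟪A u, EuclideanSpace.single (2 : Fin 3) (1 : ℝ)⟫_ℝ := by
      rw [PiLp.sub_apply, apply_two_eq_inner_e₃ (A u)]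
    rw [hP]
    refine ⟨?_, ?_, ?_, hlatu⟩
    · rw [hneg]
      exact movedFcc_add_site_mem A t hpΛ (mem_fcc_of_mem_fccSlots (neg_mem_fccSlots hu))
    · rw [e2]; linarith
    · rw [e2]; linarith
  · exfalso
    have h1 := lateral_radius_le_add_dist q p
    rw [dist_comm, hpq] at h1
    have hq : ρ - 1 < Real.sqrt (q 0 ^ 2 + q 1 ^ 2) := by
      rw [← Real.sqrt_sq (by linarith : (0 : ℝ) ≤ ρ - 1)]
      exact Real.sqrt_lt_sqrt (sq_nonneg _) hqr
    linarith

/-- **Slot pairing:** `Σ_{w ∈ fccSlots} |⟪A w, e₃⟫| = 2 Σ_{⟪A w, e₃⟫ < 0} |⟪A w, e₃⟫|` (the slots come in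
antipodal pairs `±w`). -/
theorem sum_abs_inner_eq_two_mul_sum_down
    (A : EuclideanSpace ℝ (Fin 3) ≃ₗᵢ[ℝ] EuclideanSpace ℝ (Fin 3)) :
    ∑ w ∈ fccSlots, |⟪A w, EuclideanSpace.single (2 : Fin 3) (1 : ℝ)⟫_ℝ| =
      2 * ∑ w ∈ fccSlots.filter (fun w => ⟪A w, EuclideanSpace.single (2 : Fin 3) (1 : ℝ)⟫_ℝ < 0),
        |⟪A w, EuclideanSpace.single (2 : Fin 3) (1 : ℝ)⟫_ℝ| := by
  classical
  set e₃ := EuclideanSpace.single (2 : Fin 3) (1 : ℝ) with he₃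
  set α : EuclideanSpace ℝ (Fin 3) → ℝ := fun w => ⟪A w, e₃⟫_ℝ with hα
  have hαneg : ∀ w, α (-w) = -α w := by intro w; simp only [hα, map_neg, inner_neg_left]
  have h1 : ∀ w, |α w| = max (α w) 0 + max (-α w) 0 := by
    intro w
    rcases le_total 0 (α w) with h | h
    · rw [abs_of_nonneg h, max_eq_left h, max_eq_right (by linarith)]; ring
    · rw [abs_of_nonpos h, max_eq_right h, max_eq_left (by linarith)]; ring
  have h2 : ∑ w ∈ fccSlots, max (α w) 0 = ∑ w ∈ fccSlots, max (-α w) 0 := by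
    refine Finset.sum_nbij' (fun w => -w) (fun w => -w) ?_ ?_ ?_ ?_ ?_
    · intro w hw; exact neg_mem_fccSlots hw
    · intro w hw; exact neg_mem_fccSlots hw
    · intro w _; exact neg_neg w
    · intro w _; exact neg_neg w
    · intro w _; rw [hαneg, neg_neg]
  have h3 : ∑ w ∈ fccSlots.filter (fun w => α w < 0), |α w| = ∑ w ∈ fccSlots, max (-α w) 0 := by
    rw [Finset.sum_filter]
    refine Finset.sum_congr rfl fun w _ => ?_
    split_ifs with h
    · rw [abs_of_neg h, max_eq_left (by linarith)]
    · push Not at h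
      rw [max_eq_right (by linarith)]
  show ∑ w ∈ fccSlots, |α w| = 2 * ∑ w ∈ fccSlots.filter (fun w => α w < 0), |α w|
  rw [Finset.sum_congr rfl fun w _ => h1 w, Finset.sum_add_distrib, h2, h3]
  ring

/-- **The outer credit count.**  For the clamped sample `P` of the bottom grain (`3 ≤ R₀ ≤ ρ`),
`Σ_{⟪A w,e₃⟫<0} #{p ∈ P : p + A w ∉ P} ≥ 2 φ(A⁻¹e₃) π ρ² − 120 √2 π ρ`, with the crux's
`φ(A⁻¹ e₃) = (√2/4) Σ_{slots} |⟪w, A⁻¹ e₃⟫|` written as `(√2/4) Σ_{w ∈ fccSlots} |⟪A w, e₃⟫|`. -/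
theorem outerCredits_ge
    (A : EuclideanSpace ℝ (Fin 3) ≃ₗᵢ[ℝ] EuclideanSpace ℝ (Fin 3)) (t : EuclideanSpace ℝ (Fin 3))
    (P : Finset (EuclideanSpace ℝ (Fin 3))) (R₀ ρ : ℝ) (hR₀ : 3 ≤ R₀) (hρ : R₀ ≤ ρ)
    (hP : ∀ p, p ∈ P ↔ (p ∈ (fun q => A q + t) '' fccStacking 1 (Real.sqrt (2 / 3)) ∧
      -(2 * R₀) ≤ p 2 ∧ p 2 ≤ -R₀ ∧ p 0 ^ 2 + p 1 ^ 2 ≤ ρ ^ 2)) :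
    2 * (Real.sqrt 2 / 4 * ∑ w ∈ fccSlots, |⟪A w, EuclideanSpace.single (2 : Fin 3) (1 : ℝ)⟫_ℝ|) *
        Real.pi * ρ ^ 2 - 120 * Real.sqrt 2 * Real.pi * ρ ≤
      ∑ w ∈ fccSlots.filter (fun w => ⟪A w, EuclideanSpace.single (2 : Fin 3) (1 : ℝ)⟫_ℝ < 0),
        (((P.filter fun p => p + A w ∉ P).card : ℕ) : ℝ) := by
  classical
  set e₃ := EuclideanSpace.single (2 : Fin 3) (1 : ℝ) with he₃
  set Down := fccSlots.filter (fun w => ⟪A w, e₃⟫_ℝ < 0) with hDown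
  have hP' : ∀ p, p ∈ P ↔ (p ∈ (fun q => A q + t) '' fccStacking 1 (Real.sqrt (2 / 3)) ∧
      -(2 * R₀) ≤ p 2 ∧ p 2 ≤ -(2 * R₀) + R₀ ∧ p 0 ^ 2 + p 1 ^ 2 ≤ ρ ^ 2) := by
    intro p; rw [hP p, show -(2 * R₀) + R₀ = -R₀ by ring]
  -- per class
  have hcls : ∀ w ∈ Down, Real.sqrt 2 * |⟪A w, e₃⟫_ℝ| * Real.pi * ρ ^ 2 - 10 * Real.sqrt 2 * Real.pi * ρ ≤
      (((P.filter fun p => p + A w ∉ P).card : ℕ) : ℝ) := by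
    intro w hw
    have hws : w ∈ fccSlots := (mem_filter.1 hw).1
    obtain ⟨Ea, Eb, hEa, hEb, hdet, hframe, -⟩ := exists_frame_of_mem_fccSlots hws
    exact tops_ge_lineCount A t (-(2 * R₀)) R₀ ρ (by linarith) hρ P hP' Ea Eb w hEa hEb
      (norm_eq_one_of_mem_fccSlots hws) hdet hframe
  have hsum := Finset.sum_le_sum hcls
  rw [Finset.sum_sub_distrib, Finset.sum_const, nsmul_eq_mul] at hsum
  have hcardDown : (Down.card : ℝ) ≤ 12 := by
    have : Down.card ≤ fccSlots.card := card_filter_le _ _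
    rw [card_fccSlots] at this
    exact_mod_cast this
  have hpair := sum_abs_inner_eq_two_mul_sum_down A
  have hS : ∑ w ∈ Down, Real.sqrt 2 * |⟪A w, e₃⟫_ℝ| * Real.pi * ρ ^ 2 =
      Real.sqrt 2 * Real.pi * ρ ^ 2 * ∑ w ∈ Down, |⟪A w, e₃⟫_ℝ| := by
    rw [Finset.mul_sum]; refine Finset.sum_congr rfl fun w _ => ?_; ring
  rw [hS] at hsum
  have hnn : (0 : ℝ) ≤ 10 * Real.sqrt 2 * Real.pi * ρ := by
    have : (0 : ℝ) ≤ ρ := by linarith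
    positivity
  have e : 2 * (Real.sqrt 2 / 4 * ∑ w ∈ fccSlots, |⟪A w, e₃⟫_ℝ|) * Real.pi * ρ ^ 2 =
      Real.sqrt 2 * Real.pi * ρ ^ 2 * ∑ w ∈ Down, |⟪A w, e₃⟫_ℝ| := by
    rw [hpair]; ring
  rw [e]
  nlinarith

/-- **The inner credit count.**  For the clamped sample `P ⊆ X₁` (`X₁` the grain balls of `X`,
`3 ≤ R₀ ≤ ρ`) and any slot `u`, the STRUCTURED `u`-tops of `X₁` seeded from `P`
(`q ∈ X₁`, `q + A u ∉ X₁`, `q ∈ P ∨ q − A u ∈ X₁`) number at least `√2 ⟪A u, e₃⟫ π ρ² − 10 √2 π ρ`. -/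
theorem innerCredits_ge
    (A : EuclideanSpace ℝ (Fin 3) ≃ₗᵢ[ℝ] EuclideanSpace ℝ (Fin 3)) (t : EuclideanSpace ℝ (Fin 3))
    (X₁ P : Finset (EuclideanSpace ℝ (Fin 3))) (R₀ ρ : ℝ) (hR₀ : 3 ≤ R₀) (hρ : R₀ ≤ ρ) (hPX : P ⊆ X₁)
    (hP : ∀ p, p ∈ P ↔ (p ∈ (fun q => A q + t) '' fccStacking 1 (Real.sqrt (2 / 3)) ∧
      -(2 * R₀) ≤ p 2 ∧ p 2 ≤ -R₀ ∧ p 0 ^ 2 + p 1 ^ 2 ≤ ρ ^ 2))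
    {u : EuclideanSpace ℝ (Fin 3)} (hu : u ∈ fccSlots) :
    Real.sqrt 2 * ⟪A u, EuclideanSpace.single (2 : Fin 3) (1 : ℝ)⟫_ℝ * Real.pi * ρ ^ 2 -
        10 * Real.sqrt 2 * Real.pi * ρ ≤
      (((X₁.filter fun q => q + A u ∉ X₁ ∧ (q ∈ P ∨ q - A u ∈ X₁)).card : ℕ) : ℝ) := by
  classical
  have hP' : ∀ p, p ∈ P ↔ (p ∈ (fun q => A q + t) '' fccStacking 1 (Real.sqrt (2 / 3)) ∧
      -(2 * R₀) ≤ p 2 ∧ p 2 ≤ -(2 * R₀) + R₀ ∧ p 0 ^ 2 + p 1 ^ 2 ≤ ρ ^ 2) := by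
    intro p; rw [hP p, show -(2 * R₀) + R₀ = -R₀ by ring]
  obtain ⟨Ea, Eb, hEa, hEb, hdet, hframe, -⟩ := exists_frame_of_mem_fccSlots hu
  have h1 := tops_ge_lineCount A t (-(2 * R₀)) R₀ ρ (by linarith) hρ P hP' Ea Eb u hEa hEb
    (norm_eq_one_of_mem_fccSlots hu) hdet hframe
  have hu0 : A u ≠ 0 := by
    intro h0
    have : ‖A u‖ = 0 := by rw [h0, norm_zero]
    rw [LinearIsometryEquiv.norm_map, norm_eq_one_of_mem_fccSlots hu] at this
    norm_num at this
  have h2 := card_runTops_le_structured X₁ P (A u) hu0 hPX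
    (runConvex_clampedSample A t (-(2 * R₀)) (-R₀) ρ (by linarith) P hP (mem_fcc_of_mem_fccSlots hu))
  have h2' : (((P.filter fun p => p + A u ∉ P).card : ℕ) : ℝ) ≤
      (((X₁.filter fun q => q + A u ∉ X₁ ∧ (q ∈ P ∨ q - A u ∈ X₁)).card : ℕ) : ℝ) := by
    have h2x : (P.filter fun p => p + A u ∉ P).card ≤
        (X₁.filter fun q => q + A u ∉ X₁ ∧ (q ∈ P ∨ q - A u ∈ X₁)).card := by
      convert h2 using 3
    exact_mod_cast h2x
  have h3 : Real.sqrt 2 * ⟪A u, EuclideanSpace.single (2 : Fin 3) (1 : ℝ)⟫_ℝ * Real.pi * ρ ^ 2 ≤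
      Real.sqrt 2 * |⟪A u, EuclideanSpace.single (2 : Fin 3) (1 : ℝ)⟫_ℝ| * Real.pi * ρ ^ 2 := by
    have := le_abs_self ⟪A u, EuclideanSpace.single (2 : Fin 3) (1 : ℝ)⟫_ℝ
    have hc : (0 : ℝ) ≤ Real.sqrt 2 * Real.pi * ρ ^ 2 := by positivity
    nlinarith
  linarith

end Summit.Ventures.Crystal3D.Theorems

end
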